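import Summits.AnomalousDissipation.AnomalousDissipation.Theorems.SolenoidalFractalHomogenisationLagrangianStepVmodFrameDefs
import Summits.AnomalousDissipation.AnomalousDissipation.Theorems.SolenoidalFractalHomogenisationLagrangianStepFrameConjugacyOfModulation
import HarnessLib

/-!
# K1L_D (stmt-AnomalousDissipation-27980), (ℓ3-A) road A: `FrameConjugacyAtF` FROM THE FRAME-MODULATION DATUM — the providers
# `FrameConj.frameConjugacyAtF_of_curve / _of_clamped / _of_inputs / _of_modulation`
(helper, `--supports 27980 --as helper`; prover lead-k1l-onelevel-p1 g7; tenure RULING D28-10 (a).)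

`frameConjugacyAt_of_curve` (p701171), `…_of_clamped`, `frameConjugacyAt_of_inputs` (p705630), `frameConjugacyAt_of_modulation` (p706082) VERBATIM with
the modulation datum a FRAME modulation (`CellClauseMod.IsFrameModulation`) stated DIRECTLY for the clamped curve (so no `congr` step).  The distorted
propagators are the clamped conjugate families of `…FrameConjugatePropagatorClamped` as before.
No sorry, no definition, no named fact.  NOT a proof of (M_θ), of `stub_Vmod_EHTthg`, of K1L_D or AD; rung F-D1.A0.
-/

set_option linter.dupNamespace false

noncomputable section

namespace Summit.AnomalousDissipation.AnomalousDissipation.Theorems.SolenoidalFractalHomogenisation.LagrangianStep.FrameConj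

open Set Function Filter MeasureTheory Topology
open scoped NNReal ENNReal InnerProductSpace
open Literature.Analysis Literature.Analysis.FunctionSpaces Literature.Analysis.FunctionSpaces.Torus
open Literature.Analysis.FluidPDE Literature.Analysis.FluidPDE.LatticeShear
open Literature.Analysis.FluidPDE.LatticeShear (LagrangianLatticeCarrier LatticeWord)
open Summit.AnomalousDissipation.AnomalousDissipation.Theorems.SolenoidalFractalHomogenisation.LagrangianStep.CellClauseMod
open Summit.AnomalousDissipation.AnomalousDissipation.Theorems.SolenoidalFractalHomogenisation.LagrangianStep.Z7Glue

variable {k : ℕ}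

/-- **(T4)F, general curve** — `frameConjugacyAt_of_curve` VERBATIM with a frame-modulation datum. -/
theorem frameConjugacyAtF_of_curve {W : LatticeWord k} {M : ℝ} {hM : 0 < M} {c : ℝ} {Φ : ℝ → Torus.Visc4 (Fin 3) → Torus.Visc4 (Fin 3)}
    {Cα ϱ θ : ℝ} (E : LagrangianLatticeCarrier k) (hR : E.LevelRegular) (m : ℕ) (S : Torus.Visc4 (Fin 3)) {s t : ℝ}
    (hν : 0 < E.cellVisc (m + 1)) (hθ0 : 0 ≤ θ) (hθ : θ ≤ Cα * E.θ (m + 1)) (hϱ : 0 ≤ ϱ)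
    {G : ℝ → UnitAddTorus (Fin 3) → Matrix (Fin 3) (Fin 3) ℝ} (hmod : IsFrameModulation θ (E.a (m + 1) * (t - s)) (ϱ * E.N m) G)
    {Um Um1 Ut Tt : ℝ → ℝ → (V2 →L[ℝ] V2)}
    (hUt : IsDistortedPropagator (E.a (m + 1) * (t - s)) ((1 / (E.N (m + 1) : ℝ) ^ 2) • (E.cellVisc (m + 1) • S))
      (cellField W M hM (E.cellVisc (m + 1)) hν (E.N (m + 1))) G Ut)
    (hTt : IsDistortedPropagator (E.a (m + 1) * (t - s)) ((1 / (E.N (m + 1) : ℝ) ^ 2) • (E.cellVisc (m + 1) • S +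
      (c / E.cellVisc (m + 1)) • Φ (E.cellVisc (m + 1)) ((1 / E.cellVisc (m + 1)) • (E.cellVisc (m + 1) • S)))) (fun _ _ => 0) G Tt)
    (hU0 : ∀ x : V2, Ut 0 (E.a (m + 1) * (t - s)) x = frameRead E hR m s (E.a (m + 1) * (t - s)) (Um1 s t x))
    (hT0 : Tt 0 (E.a (m + 1) * (t - s)) = (frameRead E hR m s (E.a (m + 1) * (t - s))).comp (Um s t)) :
    FrameConjugacyAtF W M hM c Φ Cα ϱ E m S Um1 Um s t := by
  have hT0' : ∀ x : V2, Tt 0 (E.a (m + 1) * (t - s)) x = frameRead E hR m s (E.a (m + 1) * (t - s)) (Um s t x) := fun x => by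
    rw [hT0, ContinuousLinearMap.comp_apply]
  refine ⟨⟨hν, by linarith⟩, θ, hθ0, hθ, ϱ * E.N m, by positivity, le_rfl, G, hmod, Ut, Tt, hUt, hTt,
    fun x => x, fun y => frameRead E hR m s (E.a (m + 1) * (t - s)) y, ?_, ?_, ?_⟩
  · intro x y _ _
    rw [hU0, hT0', ← map_sub, inner_frameRead]
  · intro x _
    unfold lossFwd
    rw [hT0', norm_frameRead]
  · intro y _
    unfold lossAdj
    rw [hT0, ContinuousLinearMap.adjoint_comp, ContinuousLinearMap.comp_apply, adjoint_frameRead_apply, norm_frameRead]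

/-- **(T4)F, clamped exact-flow curve** — `frameConjugacyAt_of_clamped` with the frame-modulation datum taken DIRECTLY for the clamped curve
(no `congr` step: `IsFrameModulation` is stated for the clamped curve). -/
theorem frameConjugacyAtF_of_clamped {W : LatticeWord k} {M : ℝ} {hM : 0 < M} {c : ℝ} {Φ : ℝ → Torus.Visc4 (Fin 3) → Torus.Visc4 (Fin 3)}
    {Cα ϱ θ : ℝ} (E : LagrangianLatticeCarrier k) (hR : E.LevelRegular) (m : ℕ) (S : Torus.Visc4 (Fin 3)) {s t : ℝ} (hst : s ≤ t)
    (hν : 0 < E.cellVisc (m + 1)) (hθ0 : 0 ≤ θ) (hθ : θ ≤ Cα * E.θ (m + 1)) (hϱ : 0 ≤ ϱ)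
    (hmod : IsFrameModulation θ (E.a (m + 1) * (t - s)) (ϱ * E.N m)
      (fun τ y => frameG E m (s + max 0 (min τ (E.a (m + 1) * (t - s))) / E.a (m + 1)) s y))
    {Um Um1 : ℝ → ℝ → (V2 →L[ℝ] V2)}
    (hUt : IsDistortedPropagator (E.a (m + 1) * (t - s)) ((1 / (E.N (m + 1) : ℝ) ^ 2) • (E.cellVisc (m + 1) • S))
      (cellField W M hM (E.cellVisc (m + 1)) hν (E.N (m + 1)))
      (fun τ y => frameG E m (s + max 0 (min τ (E.a (m + 1) * (t - s))) / E.a (m + 1)) s y)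
      (fun σ₁ σ₂ => conjProp E hR m s Um1 (max 0 (min σ₁ (E.a (m + 1) * (t - s)))) (max 0 (min σ₂ (E.a (m + 1) * (t - s))))))
    (hTt : IsDistortedPropagator (E.a (m + 1) * (t - s)) ((1 / (E.N (m + 1) : ℝ) ^ 2) • (E.cellVisc (m + 1) • S +
      (c / E.cellVisc (m + 1)) • Φ (E.cellVisc (m + 1)) ((1 / E.cellVisc (m + 1)) • (E.cellVisc (m + 1) • S)))) (fun _ _ => 0)
      (fun τ y => frameG E m (s + max 0 (min τ (E.a (m + 1) * (t - s))) / E.a (m + 1)) s y)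
      (fun σ₁ σ₂ => conjProp E hR m s Um (max 0 (min σ₁ (E.a (m + 1) * (t - s)))) (max 0 (min σ₂ (E.a (m + 1) * (t - s)))))) :
    FrameConjugacyAtF W M hM c Φ Cα ϱ E m S Um1 Um s t := by
  have hTw : 0 ≤ E.a (m + 1) * (t - s) := mul_nonneg (E.a_pos (m + 1)).le (by linarith)
  have hc0 : max 0 (min 0 (E.a (m + 1) * (t - s))) = 0 := clamp_eq_self ⟨le_rfl, hTw⟩
  have hcT : max 0 (min (E.a (m + 1) * (t - s)) (E.a (m + 1) * (t - s))) = E.a (m + 1) * (t - s) := clamp_eq_self ⟨hTw, le_rfl⟩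
  refine frameConjugacyAtF_of_curve E hR m S hν hθ0 hθ hϱ hmod hUt hTt (fun x => ?_) ?_
  · simp only [hc0, hcT]
    exact conjProp_zero_apply E hR m s t Um1 x
  · refine ContinuousLinearMap.ext fun x => ?_
    simp only [hc0, hcT, ContinuousLinearMap.comp_apply]
    exact conjProp_zero_apply E hR m s t Um x

/-- **`FrameConjugacyAtF` on a closed piece from the frame-modulation datum of the CLAMPED curve and the Eulerian representation property**
(`frameConjugacyAt_of_inputs` VERBATIM otherwise). -/
theorem frameConjugacyAtF_of_inputs (E : LagrangianLatticeCarrier k) (hL : E.LPermissible) (hR : E.LevelRegular) {W : LatticeWord k}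
    {M : ℝ} {hM : 0 < M} (hdes : E.design = W.stretch M hM) (Φ : ℝ → Torus.Visc4 (Fin 3) → Torus.Visc4 (Fin 3))
    {Cα ϱ θ : ℝ} (m j : ℕ) (S : Torus.Visc4 (Fin 3)) {t : ℝ}
    (hj0 : 0 ≤ (j : ℝ) * E.refresh (m + 1)) (hjt : (j : ℝ) * E.refresh (m + 1) < t)
    (htR : t ≤ (j : ℝ) * E.refresh (m + 1) + E.refresh (m + 1)) (ht1 : t ≤ 1)
    (hν : 0 < E.cellVisc (m + 1)) (hθ0 : 0 ≤ θ) (hθ : θ ≤ Cα * E.θ (m + 1)) (hϱ : 0 ≤ ϱ)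
    (hmod : IsFrameModulation θ (E.a (m + 1) * (t - (j : ℝ) * E.refresh (m + 1))) (ϱ * E.N m)
      (fun τ y => frameG E m ((j : ℝ) * E.refresh (m + 1)
        + max 0 (min τ (E.a (m + 1) * (t - (j : ℝ) * E.refresh (m + 1)))) / E.a (m + 1)) ((j : ℝ) * E.refresh (m + 1)) y))
    {Um Um1 : ℝ → ℝ → (V2 →L[ℝ] V2)}
    (hU1 : Torus.IsPropagator 1 (E.partialSum (m + 1)) (E.kbar (m + 1) • S) Um1)
    (hU : Torus.IsPropagator 1 (E.partialSum m) (E.kbar m • renormStep (Φ (E.cellVisc (m + 1))) (E.gain / E.cellVisc (m + 1) ^ 2) S) Um)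
    (hErepr1 : ∀ t₁ : ℝ, (j : ℝ) * E.refresh (m + 1) ≤ t₁ → t₁ < t → ∀ (φE : VF) (hφE : MemLp φE 2 volume),
      Torus.IsWeaklyDivFree φE → ∀ u : ℝ → VF,
      Torus.IsWeakTensorPassiveVectorOn 0 (t - t₁) (E.kbar (m + 1) • S) (fun τ' => E.partialSum (m + 1) (t₁ + τ')) φE u →
      ∀ᵐ τ' ∂(volume.restrict (Ioo 0 (t - t₁))), ∃ hτ : MemLp (u τ') 2 volume, hτ.toLp (u τ') = Um1 t₁ (t₁ + τ') (hφE.toLp φE))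
    (hErepr : ∀ t₁ : ℝ, (j : ℝ) * E.refresh (m + 1) ≤ t₁ → t₁ < t → ∀ (φE : VF) (hφE : MemLp φE 2 volume),
      Torus.IsWeaklyDivFree φE → ∀ u : ℝ → VF,
      Torus.IsWeakTensorPassiveVectorOn 0 (t - t₁) (E.kbar m • renormStep (Φ (E.cellVisc (m + 1))) (E.gain / E.cellVisc (m + 1) ^ 2) S)
        (fun τ' => E.partialSum m (t₁ + τ')) φE u →
      ∀ᵐ τ' ∂(volume.restrict (Ioo 0 (t - t₁))), ∃ hτ : MemLp (u τ') 2 volume, hτ.toLp (u τ') = Um t₁ (t₁ + τ') (hφE.toLp φE)) :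
    FrameConjugacyAtF W M hM E.gain Φ Cα ϱ E m S Um1 Um ((j : ℝ) * E.refresh (m + 1)) t := by
  have hL1 : ∀ (σ : ℝ) (u : V2),
      Torus.IsWeaklyDivFree (Torus.distort (frameG E m ((j : ℝ) * E.refresh (m + 1) + σ / E.a (m + 1)) ((j : ℝ) * E.refresh (m + 1)))
        (⇑(frameRead E hR m ((j : ℝ) * E.refresh (m + 1)) σ u) : VF)) ↔ Torus.IsWeaklyDivFree (⇑u : VF) :=
    fun σ u => isWeaklyDivFree_distort_frameRead_iff' E hR m _ σ u
  have hUt := isDistortedPropagator_conjProp_clamped E hR m hj0 hjt ht1 hU1 hL1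
    (𝔸c := (1 / (E.N (m + 1) : ℝ) ^ 2) • (E.cellVisc (m + 1) • S))
    (bc := cellField W M hM (E.cellVisc (m + 1)) hν (E.N (m + 1)))
    (hT1_true E hL hR hdes m j hjt.le htR S hν) hErepr1
  have hTt := isDistortedPropagator_conjProp_clamped E hR m hj0 hjt ht1 hU hL1
    (𝔸c := (1 / (E.N (m + 1) : ℝ) ^ 2) • (E.cellVisc (m + 1) • S +
      (E.gain / E.cellVisc (m + 1)) • Φ (E.cellVisc (m + 1)) ((1 / E.cellVisc (m + 1)) • (E.cellVisc (m + 1) • S))))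
    (bc := fun (_ : ℝ) (_ : UnitAddTorus (Fin 3)) => (0 : EuclideanSpace ℝ (Fin 3)))
    (hT1_coarse E hL hR m j hjt.le htR Φ S) hErepr
  exact frameConjugacyAtF_of_clamped E hR m S hjt.le hν hθ0 hθ hϱ hmod hUt hTt

/-- **`FrameConjugacyAtF` from the frame-modulation datum alone** (`frameConjugacyAt_of_modulation` VERBATIM otherwise; `hErepr` discharged by
`hErepr_partialSum`). -/
theorem frameConjugacyAtF_of_modulation (E : LagrangianLatticeCarrier k) (hL : E.LPermissible) (hR : E.LevelRegular) {W : LatticeWord k}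
    {M : ℝ} {hM : 0 < M} (hdes : E.design = W.stretch M hM) (Φ : ℝ → Torus.Visc4 (Fin 3) → Torus.Visc4 (Fin 3))
    {Cα ϱ θ : ℝ} (m j : ℕ) (S : Torus.Visc4 (Fin 3)) {t : ℝ}
    (hj0 : 0 ≤ (j : ℝ) * E.refresh (m + 1)) (hjt : (j : ℝ) * E.refresh (m + 1) < t)
    (htR : t ≤ (j : ℝ) * E.refresh (m + 1) + E.refresh (m + 1)) (ht1 : t ≤ 1)
    (hν : 0 < E.cellVisc (m + 1)) (hθ0 : 0 ≤ θ) (hθ : θ ≤ Cα * E.θ (m + 1)) (hϱ : 0 ≤ ϱ)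
    (hmod : IsFrameModulation θ (E.a (m + 1) * (t - (j : ℝ) * E.refresh (m + 1))) (ϱ * E.N m)
      (fun τ y => frameG E m ((j : ℝ) * E.refresh (m + 1)
        + max 0 (min τ (E.a (m + 1) * (t - (j : ℝ) * E.refresh (m + 1)))) / E.a (m + 1)) ((j : ℝ) * E.refresh (m + 1)) y))
    {Um Um1 : ℝ → ℝ → (V2 →L[ℝ] V2)}
    (hU1 : Torus.IsPropagator 1 (E.partialSum (m + 1)) (E.kbar (m + 1) • S) Um1)
    (hU : Torus.IsPropagator 1 (E.partialSum m) (E.kbar m • renormStep (Φ (E.cellVisc (m + 1))) (E.gain / E.cellVisc (m + 1) ^ 2) S) Um)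
    {lo₁ hi₁ lo₀ hi₀ : ℝ} (h𝔸1 : Torus.NearIso (E.kbar (m + 1) • S) lo₁ hi₁) (hlo₁ : 0 < lo₁)
    (h𝔸0 : Torus.NearIso (E.kbar m • renormStep (Φ (E.cellVisc (m + 1))) (E.gain / E.cellVisc (m + 1) ^ 2) S) lo₀ hi₀) (hlo₀ : 0 < lo₀) :
    FrameConjugacyAtF W M hM E.gain Φ Cα ϱ E m S Um1 Um ((j : ℝ) * E.refresh (m + 1)) t :=
  frameConjugacyAtF_of_inputs E hL hR hdes Φ m j S hj0 hjt htR ht1 hν hθ0 hθ hϱ hmod hU1 hU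
    (hErepr_partialSum E hR (m + 1) h𝔸1 hlo₁ hU1 hj0 ht1) (hErepr_partialSum E hR m h𝔸0 hlo₀ hU hj0 ht1)

end Summit.AnomalousDissipation.AnomalousDissipation.Theorems.SolenoidalFractalHomogenisation.LagrangianStep.FrameConj

end
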